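import Summits.CriticalPhenomena.SAWScalingLimit.Theorems.SAWDefectDecoherenceMassRatioMirrorDefs
import Summits.CriticalPhenomena.SAWScalingLimit.Theorems.SAWDefectDecoherenceMassRatioRenewalGlue

/-!
# Status of `stub_ratioMixing` (line `mirror-doubling-endpoint-restriction`, crux stmt-CriticalPhenomena-8550): BLOCKED — reduction to one named primitive
1. Missing input (ONE Prop, this file): `RatioMix.DoorAvoidanceQuasiMult` = SAW boundary quasi-multiplicativity
   (separation of scales) at a door edge, δ-free and uniform: `DoorAvoidanceQuasiMult κ` for some `κ > 0`: `∀ R≥1 ∀ (Λ, door m p, boundary root a)`,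
   `Λ` the exact half-lattice on `Ball_{4R}(door)`, `dist(mid a, door) ≥ 6R` ⟹
   `κ·Z_{Λ∪Ball_R}(a→door)·Z_{H_R}(a_R→c₀) ≤ Z_Λ(a→door)·Z_{H_R∪Ball_R}(a_R→c₀)`.
   PROVED: `DoorAvoidanceQuasiMult ⇒ stub` (registered signature verbatim, `stub_ratioMixing_of_doorAvoidanceQuasiMult`).
2. Fragments PROVED (frame, `ρ' ≤ rhoCap`, eventually in δ): `b_δ = door (m δ) p` (tree `frame_door`); `Λ_δ` is the
   exact half-lattice on `Ball_{4R}(mid b_δ)`, `R = ⌊ρ'/δ⌋ ≥ 1`; PHANTOM SPLIT (upper half-ball ⊆ Λ_δ, lower half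
   disjoint, `double = Λ_δ ⊔ lower half-ball`: the ball never touches Λ_δ elsewhere); root `≥ 6R` away; all four
   masses `> 0`; exact translation `shift (m δ) p`: `b_δ = shift c₀`, `shift H_R ⊆ Λ_δ`, `shift(H_R∪Ball_R) ⊆ Λ_δ⁺`
   (`hexCenter_shift`, `eventually_canonical_embeds`). Bracket (lead report §7): `EndpointRestriction t ∧ (canonical upper bound at t) ⇒ stub`
   and `CanonicalRestriction t ∧ stub ⇒ EndpointRestriction t` (landed glue): the stub IS the exponent transfer.
3. No proof: two ROOTS/domains compared at δ-uniform constants; last-exit switching of `(γ, shift η)` self-intersects,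
   HW/bridges give only `e^{-CR} ≤ ratio ≤ 1`, DCS sums exits from one root, reciprocity just restarts at the door —
   no domain Markov / harmonic measure / RSW for SAW (barrier `SAWNotKineticallyGrown`). No in-frame refutation:
   `Λ⁺∖Λ ⊂ B(b, ρ'+o(1))` where `Λ_δ` is rigid (proved), root corridors/fjords are common factors of both masses
   (same root, same target, nested domains), and no power of δ separates the two ratios rigorously (truth: both
   `≍ R^{-25/48}`, LSW 2004 §3.4). Lit (vsearch: Madras–Slade 1993, Lawler 2005/1991): no SAW separation lemma in print.
-/

/-!
# Crux `SAWDefectDecoherence.MassRatio` (stmt-CriticalPhenomena-8550), line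
# `mirror-doubling-endpoint-restriction` — stub `stub_ratioMixing`: the missing separation input,
# the frame fragments around it, and the reduction

Reduction file (line lead `c1`, worker wave) for the registered stub `stub_ratioMixing = ∀ datum, Mirror.RatioMixing …`
(vocabulary of `…MassRatioMirrorDefs`: `Z`, `double`, `scaleR`, `rhoCap`, `cEdge`, `aEdge`,
`canonDisc`, `RatioMixing`; frame `FlatRoot.Frame`; door edges `Renewal.door`). The stub is NOT
proved (diagnosis above). Proved here:

* `DoorAvoidanceQuasiMult` — the missing input as ONE `Prop` (uniform lattice statement), and
  `stub_ratioMixing_of_doorAvoidanceQuasiMult : DoorAvoidanceQuasiMult → ∀ D ρ Λ m a b, RatioMixing …`;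
* frame fragments: `eventually_door`, `eventually_halfLattice` (exact half-lattice on the ball of
  radius `4R` about `mid b_δ`), `eventually_phantom_split`, `eventually_root_far`,
  `eventually_masses_pos`, `eventually_canonical_embeds`;
* the door translation `shift m p` / `shiftVec m p`: `hexCenter_shift` (centres move by
  `p/2 + i·hgt·m` when `(p - m)` is even), `door_eq_map_shift`, `map_shift_aEdge`, `mid_door`,
  `shift_ball_subset`, `shift_canonDisc_subset`, `shift_double_subset`;
* `ratioMixing_of_doorAvoidanceQuasiMult` — the registered sub-goal (verbatim form).
(Recorded in the lead report, not here: with a canonical UPPER restriction bound at exponent `t` and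
`EndpointRestriction t` the stub follows too, so modulo the landed glue it is exactly the exponent
transfer frame ↔ canonical family.)

Sources: line card `Cruxes/MassRatio/Lines/mirror-doubling-endpoint-restriction.md`;
G. Lawler, O. Schramm, W. Werner, *On the scaling limit of planar self-avoiding walk* (2004) §3.4;
H. Duminil-Copin, S. Smirnov, Ann. of Math. 175 (2012); N. Madras, G. Slade, *The Self-Avoiding
Walk* (1993).
-/

noncomputable section

namespace Summit.CriticalPhenomena.SAWScalingLimit.Theorems.MassRatio.Mirror

open Literature.Probability.LatticeModels Literature.Probability.RandomPlanarGeometry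
open Literature.Probability.RandomPlanarGeometry.SAW
open Summit.CriticalPhenomena.SAWScalingLimit.Theorems.MassRatio.Negative
open Summit.CriticalPhenomena.SAWScalingLimit.Theorems.MassRatio.Renewal (Z door)
open Summit.CriticalPhenomena.SAWScalingLimit.Theorems.MassRatio.FlatRoot (Frame domainMono)
open scoped Classical

namespace RatioMix

/-! ### The missing input (ONE named Prop over tree vocabulary) -/

/-- **SAW door-avoidance quasi-multiplicativity** (boundary separation of scales for critical
self-avoiding arrivals at a flat boundary point; uniform lattice form, exponent `0`). For a finite
domain `Λ` which is the EXACT half-lattice `{row ≥ m}` on the lattice ball of radius `4R` about the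
door edge `door m p = {(m-1,p),(m,p)}` (`(p - m)` even), and a boundary root `a` at lattice distance
`≥ 6R` from the door, the avoidance ratio of the phantom ball of radius `R` hung under the door,
`Z_Λ(a → door) / Z_{Λ ∪ Ball_R}(a → door)`, is at least `κ` times the canonical one
`Z_{H_R}(a_R → c₀) / Z_{H_R ∪ Ball_R}(a_R → c₀)` — `κ > 0` absolute, written multiplied out. The
frame-wise, eventual shadow of this statement is exactly `RatioMixing` (theorem
`stub_ratioMixing_of_doorAvoidanceQuasiMult`). No proof is known: SAW has no domain Markov property /
harmonic measure / RSW (barrier `SAWNotKineticallyGrown`); predicted true for some absolute `κ > 0`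
(both ratios `≍ R^{-25/48}`, Lawler–Schramm–Werner 2004 §3.4). [folklore] -/
def DoorAvoidanceQuasiMult (κ : ℝ) : Prop :=
  ∀ R : ℕ, 1 ≤ R →
    ∀ (Λ : Finset HexVertex) (m p : ℤ) (a : Sym2 HexVertex),
      (p - m) % 2 = 0 → hexDomainSimplyConnected Λ → a ∈ hexDomainBoundary Λ →
      (∀ v : HexVertex, dist (hexCenter v) (hexMidpoint (door m p)) < 4 * (R : ℝ) →
        (v ∈ Λ ↔ m ≤ row v)) →
      6 * (R : ℝ) ≤ dist (hexMidpoint a) (hexMidpoint (door m p)) →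
      κ * (Z (double Λ (door m p) R) a (door m p) * Z (canonDisc R) (aEdge R) cEdge) ≤
        Z Λ a (door m p) * Z (double (canonDisc R) cEdge R) (aEdge R) cEdge

/-! ### Small tools -/

/-- `dist(δ z, δ w) = δ · dist(z, w)` for `δ ≥ 0`. [folklore] -/
theorem dist_smul (δ : ℝ) (hδ : 0 ≤ δ) (z w : ℂ) :
    dist ((δ : ℂ) * z) ((δ : ℂ) * w) = δ * dist z w := by
  rw [dist_eq_norm, ← mul_sub, norm_mul, Complex.norm_real, Real.norm_of_nonneg hδ, dist_eq_norm]

/-- `R δ ≤ ρ'` for `R = ⌊ρ'/δ⌋`. [folklore] -/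
theorem scaleR_mul_le {ρ' δ : ℝ} (hρ' : 0 ≤ ρ') (hδ : 0 < δ) : (scaleR ρ' δ : ℝ) * δ ≤ ρ' := by
  have h : ((⌊ρ' / δ⌋₊ : ℕ) : ℝ) ≤ ρ' / δ := Nat.floor_le (by positivity)
  unfold scaleR
  rwa [← le_div_iff₀ hδ]

/-- `R = ⌊ρ'/δ⌋ ≥ 1` once `δ ≤ ρ'`. [folklore] -/
theorem one_le_scaleR {ρ' δ : ℝ} (hδ : 0 < δ) (h : δ ≤ ρ') : 1 ≤ scaleR ρ' δ := by
  unfold scaleR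
  apply Nat.le_floor
  rw [Nat.cast_one, le_div_iff₀ hδ]
  linarith

/-- An exhibited walk makes the mass positive (`Negative.pow_length_le_norm_Z`). [folklore] -/
theorem Z_pos_of_nonempty {Λ₀ : Finset HexVertex} {r z : Sym2 HexVertex}
    (h : Nonempty (HexMidEdgeSAW Λ₀ r z)) : 0 < Z Λ₀ r z := by
  obtain ⟨γ⟩ := h
  have hx := hexCriticalFugacity_pos_lt_one.1
  exact lt_of_lt_of_le (pow_pos hx _) (pow_length_le_norm_Z Λ₀ r z γ hx.le)

/-! ### The door translation: the canonical pair embeds into any exact half-lattice piece -/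

/-- The lattice translation by `(m, p)` in brick coordinates, `(row, pos) ↦ (row + m, pos + p)`
(a graph automorphism of `ℍ` iff `(p - m)` is even; it moves centres by `p/2 + i·hgt·m`). [folklore] -/
def shift (m p : ℤ) (v : HexVertex) : HexVertex := bv (row v + m) (pos v + p)

/-- The translation vector `p/2 + i·hgt·m` of `shift m p`. [folklore] -/
def shiftVec (m p : ℤ) : ℂ := ⟨(p : ℝ) / 2, hgt * m⟩

/-- `shift` on brick vertices. -/
theorem shift_bv (m p r q : ℤ) : shift m p (bv r q) = bv (r + m) (q + p) := by
  simp [shift, row_bv, pos_bv]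

/-- `row ∘ shift m p = row + m`. -/
@[simp] theorem row_shift (m p : ℤ) (v : HexVertex) : row (shift m p v) = row v + m := by
  simp [shift]

/-- **Centres translate**: `c(shift v) = c(v) + (p/2 + i·hgt·m)` when `(p - m)` is even (the
sublattice index is preserved). -/
theorem hexCenter_shift {m p : ℤ} (h : (p - m) % 2 = 0) (v : HexVertex) :
    hexCenter (shift m p v) = hexCenter v + shiftVec m p := by
  have hv : hexCenter v = hexCenter (bv (row v) (pos v)) := by rw [bv_row_pos]
  apply Complex.ext
  · simp only [Complex.add_re, shift, re_center_bv, hexCenter_re v, shiftVec]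
    push_cast; ring
  · rw [Complex.add_im, hv, shift]
    simp only [shiftVec]
    rcases Int.emod_two_eq_zero_or_one (pos v - row v) with h0 | h1
    · have h0' : (pos v + p - (row v + m)) % 2 = 0 := by omega
      rw [im_center_bv_even h0', im_center_bv_even h0]; push_cast; ring
    · have h1' : (pos v + p - (row v + m)) % 2 = 1 := by omega
      rw [im_center_bv_odd h1', im_center_bv_odd h1]; push_cast; ring

/-- Distances to translated points are preserved. -/
theorem dist_shift {m p : ℤ} (h : (p - m) % 2 = 0) (v : HexVertex) (z : ℂ) :
    dist (hexCenter (shift m p v)) (z + shiftVec m p) = dist (hexCenter v) z := by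
  rw [hexCenter_shift h, dist_add_right]

/-- The door edge is the translate of the canonical door `c₀`. -/
theorem door_eq_map_shift (m p : ℤ) : door m p = Sym2.map (shift m p) cEdge := by
  rw [cEdge, Sym2.map_mk, shift_bv, shift_bv, door, zero_add, zero_add, neg_add_eq_sub,
    Sym2.eq_swap]

/-- The canonical root `a_R` translates to the door edge `door m (4R + p)` of the piece (at lattice
distance `2R` from `door m p` along the door line). -/
theorem map_shift_aEdge (m p : ℤ) (R : ℕ) :
    Sym2.map (shift m p) (aEdge R) = door m (4 * R + p) := by
  rw [aEdge, Sym2.map_mk, shift_bv, shift_bv, door, zero_add, neg_add_eq_sub]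

/-- `mid(door m p) = mid(c₀) + (p/2 + i·hgt·m)`. -/
theorem mid_door {m p : ℤ} (h : (p - m) % 2 = 0) :
    hexMidpoint (door m p) = hexMidpoint cEdge + shiftVec m p := by
  rw [door_eq_map_shift, cEdge, Sym2.map_mk, hexMidpoint_mk, hexMidpoint_mk,
    hexCenter_shift h, hexCenter_shift h]
  ring

/-- Lattice balls about `mid c₀` translate into lattice balls about `mid(door m p)`. -/
theorem shift_ball_subset {m p : ℤ} (h : (p - m) % 2 = 0) (r : ℝ) :
    (ball (hexMidpoint cEdge) r).image (shift m p) ⊆ ball (hexMidpoint (door m p)) r := by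
  intro w hw
  rw [Finset.mem_image] at hw
  obtain ⟨v, hv, rfl⟩ := hw
  rw [mem_ball] at hv ⊢
  rwa [mid_door h, dist_shift h]

/-- **The canonical half-disc embeds**: if `Λ₀` is the exact half-lattice `{row ≥ m}` on the
lattice ball of radius `4R` about `door m p` (`(p - m)` even), then `shift m p` maps
`H_R = canonDisc R` into `Λ₀`. -/
theorem shift_canonDisc_subset {R : ℕ} {Λ₀ : Finset HexVertex} {m p : ℤ} (h : (p - m) % 2 = 0)
    (hhalf : ∀ v : HexVertex, dist (hexCenter v) (hexMidpoint (door m p)) < 4 * (R : ℝ) →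
      (v ∈ Λ₀ ↔ m ≤ row v)) :
    (canonDisc R).image (shift m p) ⊆ Λ₀ := by
  intro w hw
  rw [Finset.mem_image] at hw
  obtain ⟨v, hv, rfl⟩ := hw
  rw [canonDisc, Finset.mem_filter, mem_ball] at hv
  refine (hhalf _ ?_).2 ?_
  · rw [mid_door h, dist_shift h]; exact hv.1
  · rw [row_shift]; linarith [hv.2]

/-- **… and so does its doubling**: `shift m p` maps `H_R ∪ Ball_R(c₀)` into `Λ₀ ∪ Ball_R(door m p)
= double Λ₀ (door m p) R`. Together with `door_eq_map_shift` / `map_shift_aEdge`: the canonical pair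
`(H_R ⊆ H_R⁺, a_R, c₀)` sits inside the pair `(Λ₀ ⊆ Λ₀⁺, door m (4R+p), door m p)` by an exact
lattice translation (so, granting translation invariance of `Z`, `Z_{H_R} ≤ Z_{Λ₀}` and
`Z_{H_R⁺} ≤ Z_{Λ₀⁺}` between the translated mid-edges by `FlatRoot.domainMono`; what is NOT
comparable this way is the mass from the frame's OWN far root `a_δ` — that is `DoorAvoidanceQuasiMult`). -/
theorem shift_double_subset {R : ℕ} {Λ₀ : Finset HexVertex} {m p : ℤ} (h : (p - m) % 2 = 0)
    (hhalf : ∀ v : HexVertex, dist (hexCenter v) (hexMidpoint (door m p)) < 4 * (R : ℝ) →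
      (v ∈ Λ₀ ↔ m ≤ row v)) :
    (double (canonDisc R) cEdge R).image (shift m p) ⊆ double Λ₀ (door m p) R := by
  rw [double, Finset.image_union, double]
  exact Finset.union_subset_union (shift_canonDisc_subset h hhalf) (shift_ball_subset h R)

/-! ### Frame fragments (all proved) -/

variable {D : DobrushinDomain} {ρ : ℝ} {Λ : ℝ → Finset HexVertex} {m : ℝ → ℤ}
  {a b : ℝ → Sym2 HexVertex}

/-- **Frame ⇒ door** (tree: `Renewal.Glue.frame_door`): eventually `b_δ = door (m δ) p`,
`(p - m δ)` even, outer endpoint off `Λ_δ`. [folklore] -/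
theorem eventually_door (hF : Frame D ρ Λ m a b) :
    ∀ᶠ δ : ℝ in nhdsWithin 0 (Set.Ioi 0),
      ∃ p : ℤ, b δ = door (m δ) p ∧ (p - m δ) % 2 = 0 ∧ bv (m δ - 1) p ∉ Λ δ :=
  Renewal.Glue.frame_door hF.1 hF.2.2.1 hF.2.2.2.2.2

/-- **Eventually `Λ_δ` is the exact half-lattice `{row ≥ m δ}` on the lattice ball of radius
`4R = 4⌊ρ'/δ⌋` about `mid b_δ`** (`ρ' ≤ rhoCap ≤ ρ/8`, so `4Rδ ≤ ρ/2`; `δ·mid b_δ → b`; rows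
clause on `B(b, ρ)`). [folklore] -/
theorem eventually_halfLattice (hF : Frame D ρ Λ m a b) {ρ' : ℝ} (hρ' : 0 < ρ')
    (hρ'c : ρ' ≤ rhoCap D ρ) :
    ∀ᶠ δ : ℝ in nhdsWithin 0 (Set.Ioi 0), ∀ v : HexVertex,
      dist (hexCenter v) (hexMidpoint (b δ)) < 4 * (scaleR ρ' δ : ℝ) → (v ∈ Λ δ ↔ m δ ≤ row v) := by
  obtain ⟨hρ, -, hadm, -, -, hb⟩ := hF
  have h8 : 8 * ρ' ≤ ρ := le_trans (by linarith) (rhoCap_le D ρ)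
  have hb' : ∀ᶠ δ : ℝ in nhdsWithin 0 (Set.Ioi 0),
      dist ((δ : ℂ) * hexMidpoint (b δ)) (D.pt 1) < ρ / 2 :=
    Metric.tendsto_nhds.1 hb (ρ / 2) (by positivity)
  have hpos : ∀ᶠ δ : ℝ in nhdsWithin 0 (Set.Ioi 0), 0 < δ := eventually_mem_nhdsWithin
  filter_upwards [hadm, hb', hpos] with δ hadmδ hbδ hδ v hv
  obtain ⟨-, -, -, -, -, -, hrows⟩ := hadmδ
  have h1 : dist ((δ : ℂ) * hexCenter v) ((δ : ℂ) * hexMidpoint (b δ)) < ρ / 2 := by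
    rw [dist_smul δ hδ.le]
    calc δ * dist (hexCenter v) (hexMidpoint (b δ)) < δ * (4 * (scaleR ρ' δ : ℝ)) :=
          mul_lt_mul_of_pos_left hv hδ
      _ = 4 * ((scaleR ρ' δ : ℝ) * δ) := by ring
      _ ≤ 4 * ρ' := by linarith [scaleR_mul_le hρ'.le hδ]
      _ ≤ ρ / 2 := by linarith
  have hball : (δ : ℂ) * hexCenter v ∈ Metric.ball (D.pt 1) ρ := by
    rw [Metric.mem_ball]
    calc dist ((δ : ℂ) * hexCenter v) (D.pt 1)
        ≤ dist ((δ : ℂ) * hexCenter v) ((δ : ℂ) * hexMidpoint (b δ)) +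
            dist ((δ : ℂ) * hexMidpoint (b δ)) (D.pt 1) := dist_triangle _ _ _
      _ < ρ / 2 + ρ / 2 := add_lt_add h1 hbδ
      _ = ρ := by ring
  exact hrows v hball

/-- **The phantom ball splits along the door line**: eventually its upper half (`row ≥ m δ`) lies in
`Λ_δ` and its lower half (`row < m δ`) is disjoint from `Λ_δ`, so the doubling is the DISJOINT union
`double (Λ δ) (b δ) R = Λ_δ ⊔ (lower half-ball)` — the doubling cuts no walk of `Λ_δ` and glues the
phantom half-ball in exactly under the door. [folklore] -/
theorem eventually_phantom_split (hF : Frame D ρ Λ m a b) {ρ' : ℝ} (hρ' : 0 < ρ')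
    (hρ'c : ρ' ≤ rhoCap D ρ) :
    ∀ᶠ δ : ℝ in nhdsWithin 0 (Set.Ioi 0),
      (∀ v ∈ ball (hexMidpoint (b δ)) (scaleR ρ' δ), (v ∈ Λ δ ↔ m δ ≤ row v)) ∧
      double (Λ δ) (b δ) (scaleR ρ' δ) =
        Λ δ ∪ (ball (hexMidpoint (b δ)) (scaleR ρ' δ)).filter (fun v => row v < m δ) ∧
      Disjoint (Λ δ) ((ball (hexMidpoint (b δ)) (scaleR ρ' δ)).filter (fun v => row v < m δ)) := by
  filter_upwards [eventually_halfLattice hF hρ' hρ'c] with δ hhalf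
  have hkey : ∀ v ∈ ball (hexMidpoint (b δ)) (scaleR ρ' δ), (v ∈ Λ δ ↔ m δ ≤ row v) := by
    intro v hv
    rw [mem_ball] at hv
    refine hhalf v (lt_of_lt_of_le hv ?_)
    have : (0 : ℝ) ≤ (scaleR ρ' δ : ℝ) := Nat.cast_nonneg _
    linarith
  refine ⟨hkey, ?_, ?_⟩
  · ext v
    simp only [double, Finset.mem_union, Finset.mem_filter]
    constructor
    · rintro (h | h)
      · exact Or.inl h
      · by_cases hr : m δ ≤ row v
        · exact Or.inl ((hkey v h).2 hr)
        · exact Or.inr ⟨h, not_le.1 hr⟩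
    · rintro (h | ⟨h, -⟩)
      · exact Or.inl h
      · exact Or.inr h
  · rw [Finset.disjoint_left]
    intro v hvΛ hv
    rw [Finset.mem_filter] at hv
    have := (hkey v hv.1).1 hvΛ
    omega

/-- **The root stays far from the door at the phantom scale**: eventually
`6R ≤ dist(mid a_δ, mid b_δ)` in lattice units (`6Rδ ≤ 6ρ' ≤ (3/4)·dist(pt 0, pt 1)` by
`rhoCap_le_dist`, while `dist(δ·mid a_δ, δ·mid b_δ) → dist(pt 0, pt 1) > 0`). [folklore] -/
theorem eventually_root_far (hF : Frame D ρ Λ m a b) {ρ' : ℝ} (hρ' : 0 < ρ')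
    (hρ'c : ρ' ≤ rhoCap D ρ) :
    ∀ᶠ δ : ℝ in nhdsWithin 0 (Set.Ioi 0),
      6 * (scaleR ρ' δ : ℝ) ≤ dist (hexMidpoint (a δ)) (hexMidpoint (b δ)) := by
  obtain ⟨hρ, -, -, -, ha, hb⟩ := hF
  have hd8 : 8 * ρ' ≤ dist (D.pt 0) (D.pt 1) := le_trans (by linarith) (rhoCap_le_dist D ρ)
  have h01 : D.pt 0 ≠ D.pt 1 := fun h => absurd (D.pt_injective h) (by decide)
  have hd : 0 < dist (D.pt 0) (D.pt 1) := dist_pos.2 h01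
  have htend : Filter.Tendsto
      (fun δ : ℝ => dist ((δ : ℂ) * hexMidpoint (a δ)) ((δ : ℂ) * hexMidpoint (b δ)))
      (nhdsWithin 0 (Set.Ioi 0)) (nhds (dist (D.pt 0) (D.pt 1))) := ha.dist hb
  have hev : ∀ᶠ δ : ℝ in nhdsWithin 0 (Set.Ioi 0), 3 * dist (D.pt 0) (D.pt 1) / 4 <
      dist ((δ : ℂ) * hexMidpoint (a δ)) ((δ : ℂ) * hexMidpoint (b δ)) :=
    htend.eventually_const_lt (by linarith)
  have hpos : ∀ᶠ δ : ℝ in nhdsWithin 0 (Set.Ioi 0), 0 < δ := eventually_mem_nhdsWithin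
  filter_upwards [hev, hpos] with δ hevδ hδ
  rw [dist_smul δ hδ.le] at hevδ
  have hRδ := scaleR_mul_le hρ'.le hδ
  have h7 : δ * (6 * (scaleR ρ' δ : ℝ)) < δ * dist (hexMidpoint (a δ)) (hexMidpoint (b δ)) :=
    calc δ * (6 * (scaleR ρ' δ : ℝ)) = 6 * ((scaleR ρ' δ : ℝ) * δ) := by ring
      _ ≤ 3 * dist (D.pt 0) (D.pt 1) / 4 := by linarith
      _ < δ * dist (hexMidpoint (a δ)) (hexMidpoint (b δ)) := hevδ
  exact (lt_of_mul_lt_mul_left h7 hδ.le).le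

/-- **Eventually all four masses of `RatioMixing` are positive**: `Z_Λ(a_δ → b_δ) > 0` (the frame's
`Nonempty`-SAW clause), `Z_{Λ⁺} ≥ Z_Λ` (`FlatRoot.domainMono`), and the canonical pair
(`canonical_pos`, `R ≥ 1` once `δ ≤ ρ'`). So `RatioMixing` is a genuine comparison of two positive
avoidance ratios, never vacuous. [folklore] -/
theorem eventually_masses_pos (hF : Frame D ρ Λ m a b) {ρ' : ℝ} (hρ' : 0 < ρ') :
    ∀ᶠ δ : ℝ in nhdsWithin 0 (Set.Ioi 0),
      0 < Z (Λ δ) (a δ) (b δ) ∧ 0 < Z (double (Λ δ) (b δ) (scaleR ρ' δ)) (a δ) (b δ) ∧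
      0 < Z (canonDisc (scaleR ρ' δ)) (aEdge (scaleR ρ' δ)) cEdge ∧
      0 < Z (double (canonDisc (scaleR ρ' δ)) cEdge (scaleR ρ' δ)) (aEdge (scaleR ρ' δ)) cEdge := by
  obtain ⟨hρ, -, hadm, -, -, -⟩ := hF
  have hpos : ∀ᶠ δ : ℝ in nhdsWithin 0 (Set.Ioi 0), 0 < δ := eventually_mem_nhdsWithin
  have hsmall : ∀ᶠ δ : ℝ in nhdsWithin 0 (Set.Ioi 0), δ < ρ' :=
    Filter.mem_of_superset (Ioo_mem_nhdsGT hρ') fun δ hδ => hδ.2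
  filter_upwards [hadm, hpos, hsmall] with δ hadmδ hδ hδρ'
  obtain ⟨-, -, -, hne, -, -, -⟩ := hadmδ
  have hR1 : 1 ≤ scaleR ρ' δ := one_le_scaleR hδ hδρ'.le
  have h1 : 0 < Z (Λ δ) (a δ) (b δ) := Z_pos_of_nonempty hne
  have h3 := canonical_pos _ hR1
  exact ⟨h1, lt_of_lt_of_le h1 (domainMono _ _ _ _ (subset_double _ _ _)), h3,
    lt_of_lt_of_le h3 (domainMono _ _ _ _ (subset_double _ _ _))⟩

/-- **In the frame the canonical pair embeds at every matched scale**: eventually there is a door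
position `p` with `b_δ = door (m δ) p = shift(c₀)`, `shift(H_R) ⊆ Λ_δ` and
`shift(H_R ∪ Ball_R) ⊆ double (Λ δ) (b δ) R`, `R = ⌊ρ'/δ⌋`, where `shift = shift (m δ) p`. -/
theorem eventually_canonical_embeds (hF : Frame D ρ Λ m a b) {ρ' : ℝ} (hρ' : 0 < ρ')
    (hρ'c : ρ' ≤ rhoCap D ρ) :
    ∀ᶠ δ : ℝ in nhdsWithin 0 (Set.Ioi 0), ∃ p : ℤ, (p - m δ) % 2 = 0 ∧
      b δ = Sym2.map (shift (m δ) p) cEdge ∧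
      (canonDisc (scaleR ρ' δ)).image (shift (m δ) p) ⊆ Λ δ ∧
      (double (canonDisc (scaleR ρ' δ)) cEdge (scaleR ρ' δ)).image (shift (m δ) p) ⊆
        double (Λ δ) (b δ) (scaleR ρ' δ) := by
  filter_upwards [eventually_door hF, eventually_halfLattice hF hρ' hρ'c] with δ hdoorδ hhalfδ
  obtain ⟨p, hbd, hpar, -⟩ := hdoorδ
  rw [hbd] at hhalfδ ⊢
  exact ⟨p, hpar, door_eq_map_shift _ _, shift_canonDisc_subset hpar hhalfδ,
    shift_double_subset hpar hhalfδ⟩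

/-! ### The reduction: the missing input gives the registered stub verbatim -/

/-- **`DoorAvoidanceQuasiMult ⇒ stub_ratioMixing`** (registered signature, verbatim): in the frame,
eventually `b_δ = door (m δ) p` (`eventually_door`), `Λ_δ` is the exact half-lattice on the ball of
radius `4R` about it (`eventually_halfLattice`), the root is `≥ 6R` away (`eventually_root_far`) and
`R = ⌊ρ'/δ⌋ ≥ 1`; apply the uniform lattice statement at `(Λ_δ, m δ, p, a_δ)` with `c = κ`. -/
theorem stub_ratioMixing_of_doorAvoidanceQuasiMult {κ : ℝ} (hκ : 0 < κ)
    (H : DoorAvoidanceQuasiMult κ) :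
    ∀ (D : DobrushinDomain) (ρ : ℝ) (Λ : ℝ → Finset HexVertex) (m : ℝ → ℤ)
      (a b : ℝ → Sym2 HexVertex), RatioMixing D ρ Λ m a b := by
  intro D ρ Λ m a b hF ρ' hρ' hρ'c
  refine ⟨κ, hκ, ?_⟩
  have hadm := hF.2.2.1
  have hpos : ∀ᶠ δ : ℝ in nhdsWithin 0 (Set.Ioi 0), 0 < δ := eventually_mem_nhdsWithin
  have hsmall : ∀ᶠ δ : ℝ in nhdsWithin 0 (Set.Ioi 0), δ < ρ' :=
    Filter.mem_of_superset (Ioo_mem_nhdsGT hρ') fun δ hδ => hδ.2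
  filter_upwards [hadm, eventually_door hF, eventually_halfLattice hF hρ' hρ'c,
    eventually_root_far hF hρ' hρ'c, hpos, hsmall] with δ hadmδ hdoorδ hhalfδ hfarδ hδ hδρ'
  obtain ⟨hsc, haB, -, -, -, -, -⟩ := hadmδ
  obtain ⟨p, hbd, hpar, -⟩ := hdoorδ
  have hR1 : 1 ≤ scaleR ρ' δ := one_le_scaleR hδ hδρ'.le
  rw [hbd] at hhalfδ hfarδ ⊢
  exact H (scaleR ρ' δ) hR1 (Λ δ) (m δ) p (a δ) hpar hsc haB hhalfδ hfarδ

/-- **Registered sub-goal (verbatim form): door-avoidance quasi-multiplicativity with some absolute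
constant implies the line's stub `stub_ratioMixing` at every datum.** -/
theorem ratioMixing_of_doorAvoidanceQuasiMult : ∀ κ : ℝ, 0 < κ → DoorAvoidanceQuasiMult κ → ∀ (D : DobrushinDomain) (ρ : ℝ) (Λ : ℝ → Finset HexVertex) (m : ℝ → ℤ) (a b : ℝ → Sym2 HexVertex), RatioMixing D ρ Λ m a b := by
  intro κ hκ H
  exact stub_ratioMixing_of_doorAvoidanceQuasiMult hκ H

end RatioMix

end Summit.CriticalPhenomena.SAWScalingLimit.Theorems.MassRatio.Mirror
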